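import Summits.BirchSwinnertonDyer.BirchSwinnertonDyer.Theorems.PrintX11aLowerHalfOddPrimeStub
import Summits.BirchSwinnertonDyer.BirchSwinnertonDyer.Theorems.PrintX11aUpperNonSurjThreeCorollary18OfMazur
import Literature.NumberTheory.EllipticCurves.Kato2004.IwasawaCohomologyExistsProofs
import Summits.BirchSwinnertonDyer.BirchSwinnertonDyer.Theses.ErratumRoadFive
import Summits.BirchSwinnertonDyer.BirchSwinnertonDyer.Theses.PrintX11a
import HarnessLib

/-!
# Route `PrintX11a` ∕ `ErratumRoadFive`, crux L = `X11aLowerHalf` (item stmt-BirchSwinnertonDyer-19064): the crux body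
# RE-KEYED ON PRINT-EXACT FACTS — Kato §17.13 in the contragredient form V′ ∕ VI′ ∕ XI′, Greenberg–Stevens at ODD primes only,
# Greenberg 1.5 ∕ Wuthrich Cor. 18 ∕ Kato's `nonempty_iwasawaH1Data` discharged — so that the line «birth» can retire item 19949
# (cell `bsd-print-x11a`, LEAD seat `bsd-line-x11a-p1` gen 1, D-0154 row 11; `--supports stmt-BirchSwinnertonDyer-19064`; ASK W-L1 / REF caveat C2)

HONEST FRAMING.  BSD is not proved by any of this; nothing is asserted about any curve; theorems only (no definition, no named fact
minted, no `sorry`); every theorem is CONDITIONAL on displayed statement-only named PUBLISHED facts and on displayed `∀`-hypotheses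
(the registered stubs of line «birth» r5: Greenberg's analytic `μ = 0` on the deep surjective X11a pairs at `p ≥ 5`, K2's item 19948 on
the non-surjective ones, the off-Kodaira member statement at `p = 3`).  Item 19064 does NOT close by this file.

WHY (REF g18 line police of birth r5, caveat C2; lead's ASK W-L1).  The composition of record of crux L,
`OddChain.x11aLowerHalf_body_of_muAnFive_mazur_memberRatEqAtThree_of_facts` (er5-p2 g2, p616834), reads its Kato §17.13 inputs in the
γ-keyed form `Kato2004.exists_multDivisibilityInputs_{nonsplit,split,fine}` (rider R-48: STRONGER than print by the choice of `ι`), reads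
Greenberg–Stevens as `∀ W p, greenberg_stevens` (which includes the `p = 2` instance that has no printed proof — x11a-p2 g4), and reads
Greenberg 1999 Thm. 1.5, Wuthrich 2014 Cor. 18 and GZK from K2's bundle 19949.  Width seat x11a-p2 g3 migrated the UPPER crux U3 to the
print-exact currency (p619657 → p625569); this file does the same for the LOWER crux:
* §1 `ClassX11a.missingLowerBoundAt_of_member_of_ratEq_of_not_surj_contra` — the per-pair door at a NON-surjective pair with the typed
  divisibility supplied by x11a-p2 g3's `X11b.multDivisibilityAt_of_katoFacts_of_muAnZeroAt_contra_of_mazur` (V′ ∕ VI′ ∕ XI′ + Kato 12.4 +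
  modularity + Mazur Cor. 4.1; Cor. 18 and Greenberg 1.5 are theorems at the pair; `Kato2004.nonempty_iwasawaH1Data` is the tree theorem
  `…_holds`), everything else as in er5-p2's `…_of_not_surj` (p615570);
* §2 `x11aLowerHalf_body_of_forall_muAn_member_ratEq_of_contraFacts` — the class-level body with Greenberg–Stevens keyed
  `∀ W p, p ≠ 2 → greenberg_stevens` (used at the pair's own odd `p` only);
* §3 `x11aLowerHalf_body_of_muAnFive_mazur_memberRatEqAtThree_of_contraFacts` — the shape the skeleton consumes: the two `∀`-inputs of
  birth r4/r5 (`hcert5` = μ^an on the deep pairs at `p ≥ 5`, `hmem3` = member-with-rational-equality on the deep pairs at `p = 3`), Wan's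
  Thm. 4 discharging the member at `p ≥ 5` and x11a-p2 g2's μ₃ THEOREM (mod Mazur) the certificate at `p = 3`.
Displayed facts after the re-key (all print-exact per the cell referee's ledger, none γ-keyed): modularity `exists_isNewformOf`; EPW 2006
Thm. 3.1.1 ∕ Thm. 1 ∕ Thm. 5.1.3 at an odd prime; Wan 2015 Thm. 4 (irred); Deligne–Serre 6.1; Hida 3.26; Kato–Wuthrich A32; Wuthrich Lemma 20;
Kato 12.4; Kato §17.13 V′ ∕ VI′ ∕ XI′; Stein–Wuthrich 6.1 ×2; GZK; Greenberg–Stevens (odd p); Mazur Cor. 4.1 — FIFTEEN.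

References: [Kato2004Asterisque] Thm. 12.4 (p. 221), §17.13 (pp. 279–280); [Wuthrich2014] Thm. 3, Cor. 18–19, Lemma 20; [SteinWuthrich2013]
Thm. 6.1; [EmertonPollackWeston2006] Thm. 1, 3.1.1, 5.1.3; [Wan2015] Thm. 4; [Mazur1978] Cor. 4.1; [Kobayashi2006DocMath] Cor. 4.2;
[GreenbergLNM1716] Conj. 1.11; tree `Theorems/PrintX11aLowerHalfOddPrime{Doors,Stub}.lean` (er5-p2 g2), `Theorems/PrintX11aUpperNonSurjThreeCorollary18OfMazur.lean` (x11a-p2 g3).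
-/

set_option linter.dupNamespace false
set_option autoImplicit false

noncomputable section

open scoped Classical MatrixGroups ModularForm

open CongruenceSubgroup UpperHalfPlane WeierstrassCurve Literature.NumberTheory.EllipticCurves
  Literature.NumberTheory.EllipticCurves.ModularForms
  Literature.NumberTheory.EllipticCurves.Rank1Residual
  Literature.NumberTheory.EllipticCurves.Rank1Residual.Typed
  Literature.NumberTheory.EllipticCurves.Wuthrich2014
  Literature.NumberTheory.EllipticCurves.SteinWuthrich2013
  Literature.NumberTheory.EllipticCurves.Greenberg1999
  Literature.NumberTheory.EllipticCurves.Kato2004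
  Literature.NumberTheory.EllipticCurves.GreenbergVatsal2000
  Literature.NumberTheory.EllipticCurves.EmertonPollackWeston2006
  Literature.NumberTheory.GaloisRepresentations
  Summit.BirchSwinnertonDyer.Rank1Residual
  Summit.BirchSwinnertonDyer.Rank1Residual.X1.MuLambda
  Summit.BirchSwinnertonDyer.Rank1Residual.X11a
  Summit.BirchSwinnertonDyer.Rank1Residual.X11a.LambdaNorm
  Summit.BirchSwinnertonDyer.Rank1Residual.X11a.Chain

namespace Summit.BirchSwinnertonDyer.BirchSwinnertonDyer.Theorems.OddChain

/-! ### §1 The per-pair door at a NON-surjective pair, contragredient Kato packages -/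

section Doors

variable {W : WeierstrassCurve ℚ} [W.IsElliptic] [W.IsGloballyMinimal] {p : ℕ} [Fact p.Prime]

/-- **The lower half at a NON-surjective X11a pair, ANY odd `p`, from the certificate, ONE member with the rational equality, and
PRINT-EXACT named facts**: er5-p2's `ClassX11a.missingLowerBoundAt_of_member_of_ratEq_of_not_surj` with the typed divisibility
`X11b.MultDivisibilityAt W p` supplied by `X11b.multDivisibilityAt_of_katoFacts_of_muAnZeroAt_contra_of_mazur` (Kato 12.4 `h12`, modularity
`hNf`, §17.13 V′ `hns'` ∕ VI′ `hsp'` ∕ XI′ `hfine'`, Mazur Cor. 4.1 `hMz`; Wuthrich Cor. 18 and Greenberg 1.5 are theorems at the pair;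
`nonempty_iwasawaH1Data` is `…_holds`).  PER PAIR; CONDITIONAL; closes nothing class-wide.
[cite: Kato2004Asterisque, Thm. 12.4 (p. 221), §17.13 (pp. 279–280)] [cite: Mazur1978, Cor. 4.1] [cite: EmertonPollackWeston2006, Thm. 5.1.3]
[cite: SteinWuthrich2013, Thm. 6.1 (p. 20)] [cite: Miller2011LMS, Def. 1.1] -/
theorem _root_.Summit.BirchSwinnertonDyer.Rank1Residual.ClassX11a.missingLowerBoundAt_of_member_of_ratEq_of_not_surj_contra
    (hNf : exists_isNewformOf)
    (h311 : thm311_cotorsion_weightK_member_ofLevel_odd) (hT1a : thm1_muAlg_of_weightK_member_ofLevel_odd)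
    (hT1b : thm513_transfer_from_weightK_member_of_bdd_ofLevel_odd)
    (h61 : DeligneSerre1974.thm61_exists_adicGaloisRep) (h326 : Hida2000_thm326_ordinary)
    (h12 : Kato2004.thm12_4)
    (hns' : Kato2004.exists_multDivisibilityInputs_nonsplit_contra)
    (hsp' : Kato2004.exists_multDivisibilityInputs_split_contra)
    (hfine' : Kato2004.exists_multDivisibilityInputs_fine_contra)
    (hMz : mazur_not_dvd_maninConstant_of_odd)
    (hJs : thm61_splitMultiplicative) (hJn : thm61_nonsplitMultiplicative)
    (hGZK : rank_eq_analyticRank_of_analyticRank_le_one)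
    (hGS : greenberg_stevens (W := W) (p := p))
    (hX : ClassX11a W p) (hnsj : ¬ Surj W p) (hμ : X11a.MuAnZeroAt W p)
    {M : ℕ} [NeZero M] (hpM : ¬ p ∣ M) {k : ℤ} (g : CuspForm (Gamma0 M) k)
    (ι : coeffField g →+* PadicAlgCl p) (hmem : IsOrdinaryMemberOfLevel W p g ι) (hRat : RatEqAtMember p g ι) :
    MissingLowerBoundAt W p :=
  hX.missingLowerBoundAt_of_member_of_ratEq_of_multDivisibilityAt hNf h311 hT1a hT1b h61 h326 hJs hJn hGZK hGS
    (X11b.multDivisibilityAt_of_katoFacts_of_muAnZeroAt_contra_of_mazur Kato2004.nonempty_iwasawaH1Data_holds h12 hNf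
      hns' hsp' hfine' hMz W p hX.ne_two hX.mult hX.irr hnsj hμ)
    hμ hpM g ι hmem hRat

end Doors

/-! ### §2 Class level: the crux body from ONE shape of per-pair input, print-exact facts, odd-keyed Greenberg–Stevens -/

section ClassLevel

/-- **The WHOLE body of crux `X11aLowerHalf` at EVERY odd `p` from ONE SHAPE of per-pair input on the deep pairs** — (certificate
`μ^an(E,p) = 0`, a good-ordinary member of `H(E[p])` with the rational cyclotomic equality) — er5-p2's
`x11aLowerHalf_body_of_forall_muAn_member_ratEq_of_facts` (p615570) RE-KEYED: Kato §17.13 in the `_contra` form, Mazur Cor. 4.1 in place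
of Greenberg 1.5 ∕ Cor. 18, Greenberg–Stevens at ODD primes only (`hGS W p hX.ne_two`).  Surjective image ⟹ `p`-adic surjectivity (Serre at
`p ≥ 5`, Lemma 20 at `3`) ⟹ A32; non-surjective ⟹ §1; unit pairs free.  CONDITIONAL; closes nothing by itself.
[cite: EmertonPollackWeston2006, Thm. 1, Thm. 3.1.1, Thm. 5.1.3, Notation p. 5] [cite: Wan2015, Thm. 4 (p. 4)]
[cite: Wuthrich2014, Thm. 3, Cor. 19 and Lemma 20 (p. 399)] [cite: Kato2004Asterisque, §17.13 (pp. 279–280)] [cite: Kobayashi2006DocMath, Cor. 4.2]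
[cite: Miller2011LMS, Def. 1.1] -/
theorem x11aLowerHalf_body_of_forall_muAn_member_ratEq_of_contraFacts
    (hNf : exists_isNewformOf)
    (h311 : thm311_cotorsion_weightK_member_ofLevel_odd) (hT1a : thm1_muAlg_of_weightK_member_ofLevel_odd)
    (hT1b : thm513_transfer_from_weightK_member_of_bdd_ofLevel_odd)
    (h61 : DeligneSerre1974.thm61_exists_adicGaloisRep) (h326 : Hida2000_thm326_ordinary)
    (hKato : kato_charIdeal_dvd_multiplicative_of_surjective)
    (h20 : lemma20_surjective_threeAdic_of_semistable)
    (h12 : Kato2004.thm12_4)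
    (hns' : Kato2004.exists_multDivisibilityInputs_nonsplit_contra)
    (hsp' : Kato2004.exists_multDivisibilityInputs_split_contra)
    (hfine' : Kato2004.exists_multDivisibilityInputs_fine_contra)
    (hMz : mazur_not_dvd_maninConstant_of_odd)
    (hJs : thm61_splitMultiplicative) (hJn : thm61_nonsplitMultiplicative)
    (hGZK : rank_eq_analyticRank_of_analyticRank_le_one)
    (hGS : ∀ (W : WeierstrassCurve ℚ) [W.IsElliptic] [W.IsGloballyMinimal] (p : ℕ) [Fact p.Prime],
      p ≠ 2 → greenberg_stevens (W := W) (p := p))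
    (hcert : ∀ (W : WeierstrassCurve ℚ) [W.IsElliptic] [W.IsGloballyMinimal] (p : ℕ) [Fact p.Prime],
      ClassX11a W p → ¬ X11a.ShaAnUnit W p → X11a.MuAnZeroAt W p ∧ MemberRatEqAt W p) :
    ∀ (W : WeierstrassCurve ℚ) [W.IsElliptic] [W.IsGloballyMinimal] (p : ℕ) [Fact p.Prime],
      ClassX11a W p → MissingLowerBoundAt W p := by
  intro W _ _ p hpF hX
  by_cases hu : X11a.ShaAnUnit W p
  · exact x11a_missingLowerBoundAt_of_shaAnUnit hu
  obtain ⟨hμ, M, _, hpM, k, g, ι, hmem, hRat⟩ := hcert W p hX hu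
  by_cases hsurj : Surj W p
  · have hsurj' : ∀ n : ℕ, W.HasSurjectiveModNGaloisRep (p ^ n : ℕ) := by
      by_cases hp3 : p = 3
      · subst hp3
        exact h20 W (Or.inr hX.mult) hsurj
      · exact kato_charIdeal_dvd_multiplicative_of_surjective.surjective_pow_of_five_le W p
          ((Fact.out : p.Prime).five_le_of_ne_two_of_ne_three hX.ne_two hp3) hsurj
    exact hX.missingLowerBoundAt_of_member_of_ratEq_of_surjective_pow hNf h311 hT1a hT1b h61 h326 hKato
      hJs hJn hGZK (hGS W p hX.ne_two) hsurj' hμ hpM g ι hmem hRat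
  · exact hX.missingLowerBoundAt_of_member_of_ratEq_of_not_surj_contra hNf h311 hT1a hT1b h61 h326 h12 hns' hsp'
      hfine' hMz hJs hJn hGZK (hGS W p hX.ne_two) hsurj hμ hpM g ι hmem hRat

/-! ### §3 The shape the skeleton consumes: birth r4/r5's two `∀`-inputs, print-exact facts -/

/-- **The WHOLE body of crux `X11aLowerHalf` from FIFTEEN print-exact named facts + the two `∀`-inputs of line «birth» r4/r5**:
`hcert5` = Greenberg's analytic `μ = 0` at the deep X11a pairs with `p ≥ 5` (r5: 19948 on the non-surjective side + `stub_muAnSurjDeepFive`),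
`hmem3` = «a 3-ordinary member with the rational cyclotomic equality» at the deep X11a pairs with `p = 3` (r5: Kodaira part closed,
`stub_memberRatEqAtThree_offKodaira`).  At `p ≥ 5` the member is DISCHARGED by Wan's Thm. 4 (`memberRatEqAt_of_wan_of_five_le`); at `p = 3` the
certificate is x11a-p2 g2's THEOREM `MultThreeMuAn.muAnZeroAt_three_of_mult_of_irr` (mod Mazur Cor. 4.1, `hMz`).  = er5-p2 g2's
`x11aLowerHalf_body_of_muAnFive_mazur_memberRatEqAtThree_of_facts` (p616834) RE-KEYED per §1–§2: no γ-keyed Kato fact, no Greenberg 1.5, no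
Cor. 18, no all-prime Greenberg–Stevens.  CONDITIONAL; closes nothing by itself.
[cite: Wan2015, Thm. 4 (pp. 4–5)] [cite: Mazur1978, Cor. 4.1] [cite: EmertonPollackWeston2006, Thm. 5.1.3] [cite: Kato2004Asterisque, §17.13 (pp. 279–280)]
[cite: GreenbergLNM1716, §1 Conj. 1.11 (p. 61)] [cite: Miller2011LMS, Def. 1.1] -/
theorem x11aLowerHalf_body_of_muAnFive_mazur_memberRatEqAtThree_of_contraFacts
    (hNf : exists_isNewformOf)
    (h311 : thm311_cotorsion_weightK_member_ofLevel_odd) (hT1a : thm1_muAlg_of_weightK_member_ofLevel_odd)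
    (hT2 : Wan2015.thm4_rational_weightK_member_of_bdd_ofLevel_irred)
    (hT1b : thm513_transfer_from_weightK_member_of_bdd_ofLevel_odd)
    (h61 : DeligneSerre1974.thm61_exists_adicGaloisRep) (h326 : Hida2000_thm326_ordinary)
    (hKato : kato_charIdeal_dvd_multiplicative_of_surjective)
    (h20 : lemma20_surjective_threeAdic_of_semistable)
    (h12 : Kato2004.thm12_4)
    (hns' : Kato2004.exists_multDivisibilityInputs_nonsplit_contra)
    (hsp' : Kato2004.exists_multDivisibilityInputs_split_contra)
    (hfine' : Kato2004.exists_multDivisibilityInputs_fine_contra)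
    (hMz : mazur_not_dvd_maninConstant_of_odd)
    (hJs : thm61_splitMultiplicative) (hJn : thm61_nonsplitMultiplicative)
    (hGZK : rank_eq_analyticRank_of_analyticRank_le_one)
    (hGS : ∀ (W : WeierstrassCurve ℚ) [W.IsElliptic] [W.IsGloballyMinimal] (p : ℕ) [Fact p.Prime],
      p ≠ 2 → greenberg_stevens (W := W) (p := p))
    (hcert5 : ∀ (W : WeierstrassCurve ℚ) [W.IsElliptic] [W.IsGloballyMinimal] (p : ℕ) [Fact p.Prime],
      ClassX11a W p → 5 ≤ p → ¬ X11a.ShaAnUnit W p → X11a.MuAnZeroAt W p)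
    (hmem3 : ∀ (W : WeierstrassCurve ℚ) [W.IsElliptic] [W.IsGloballyMinimal] (p : ℕ) [Fact p.Prime],
      ClassX11a W p → p = 3 → ¬ X11a.ShaAnUnit W p → MemberRatEqAt W p) :
    ∀ (W : WeierstrassCurve ℚ) [W.IsElliptic] [W.IsGloballyMinimal] (p : ℕ) [Fact p.Prime],
      ClassX11a W p → MissingLowerBoundAt W p :=
  x11aLowerHalf_body_of_forall_muAn_member_ratEq_of_contraFacts hNf h311 hT1a hT1b h61 h326 hKato h20 h12 hns' hsp' hfine'
    hMz hJs hJn hGZK hGS fun W _ _ p _ hX hu => by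
      by_cases hp3 : p = 3
      · refine ⟨?_, hmem3 W p hX hp3 hu⟩
        subst hp3
        exact MultThreeMuAn.muAnZeroAt_three_of_mult_of_irr hMz W hX.mult hX.irr
      · have hp5 : 5 ≤ p := (Fact.out : p.Prime).five_le_of_ne_two_of_ne_three hX.ne_two hp3
        exact ⟨hcert5 W p hX hp5 hu, memberRatEqAt_of_wan_of_five_le W p hNf hT2 hp5 hX.mult hX.irr⟩

/-- **The same with the fifteen facts BUNDLED into one conjunction** (the text a line skeleton registers as its fact stub; the order is
the binder order above). [cite: Kato2004Asterisque, §17.13 (pp. 279–280)] [cite: Wan2015, Thm. 4 (pp. 4–5)] [cite: Mazur1978, Cor. 4.1] -/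
theorem x11aLowerHalf_body_of_muAnFive_memberRatEqAtThree_of_printFactsLower
    (hP : exists_isNewformOf ∧
      thm311_cotorsion_weightK_member_ofLevel_odd ∧ thm1_muAlg_of_weightK_member_ofLevel_odd ∧
      Wan2015.thm4_rational_weightK_member_of_bdd_ofLevel_irred ∧
      thm513_transfer_from_weightK_member_of_bdd_ofLevel_odd ∧
      DeligneSerre1974.thm61_exists_adicGaloisRep ∧ Hida2000_thm326_ordinary ∧
      kato_charIdeal_dvd_multiplicative_of_surjective ∧ lemma20_surjective_threeAdic_of_semistable ∧
      Kato2004.thm12_4 ∧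
      Kato2004.exists_multDivisibilityInputs_nonsplit_contra ∧
      Kato2004.exists_multDivisibilityInputs_split_contra ∧
      Kato2004.exists_multDivisibilityInputs_fine_contra ∧
      mazur_not_dvd_maninConstant_of_odd ∧
      thm61_splitMultiplicative ∧ thm61_nonsplitMultiplicative ∧
      rank_eq_analyticRank_of_analyticRank_le_one ∧
      (∀ (W : WeierstrassCurve ℚ) [W.IsElliptic] [W.IsGloballyMinimal] (p : ℕ) [Fact p.Prime],
        p ≠ 2 → greenberg_stevens (W := W) (p := p)))
    (hcert5 : ∀ (W : WeierstrassCurve ℚ) [W.IsElliptic] [W.IsGloballyMinimal] (p : ℕ) [Fact p.Prime],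
      ClassX11a W p → 5 ≤ p → ¬ X11a.ShaAnUnit W p → X11a.MuAnZeroAt W p)
    (hmem3 : ∀ (W : WeierstrassCurve ℚ) [W.IsElliptic] [W.IsGloballyMinimal] (p : ℕ) [Fact p.Prime],
      ClassX11a W p → p = 3 → ¬ X11a.ShaAnUnit W p → MemberRatEqAt W p) :
    ∀ (W : WeierstrassCurve ℚ) [W.IsElliptic] [W.IsGloballyMinimal] (p : ℕ) [Fact p.Prime],
      ClassX11a W p → MissingLowerBoundAt W p := by
  obtain ⟨hNf, h311, hT1a, hT2, hT1b, h61, h326, hKato, h20, h12, hns', hsp', hfine', hMz, hJs, hJn, hGZK, hGS⟩ := hP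
  exact x11aLowerHalf_body_of_muAnFive_mazur_memberRatEqAtThree_of_contraFacts hNf h311 hT1a hT2 hT1b h61 h326 hKato h20
    h12 hns' hsp' hfine' hMz hJs hJn hGZK hGS hcert5 hmem3

/-- **Crux L BY NAME from the fifteen print-exact facts and the two `∀`-inputs of line «birth»** (glue shape; CONDITIONAL; the gate
records a `conditional-result`; closes nothing): `Theses.ErratumRoadFive.X11aLowerHalf` (= `Theses.PrintX11a.X11aLowerHalf`, `Iff.rfl`).
[cite: GreenbergLNM1716, §1 Conj. 1.11 (p. 61)] [cite: Wan2015, Thm. 4 (pp. 4–5)] [cite: Kato2004Asterisque, §17.13 (pp. 279–280)] -/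
theorem x11aLowerHalf_of_printFactsLower_of_muAnFive_of_memberRatEqAtThree
    (hP : exists_isNewformOf ∧
      thm311_cotorsion_weightK_member_ofLevel_odd ∧ thm1_muAlg_of_weightK_member_ofLevel_odd ∧
      Wan2015.thm4_rational_weightK_member_of_bdd_ofLevel_irred ∧
      thm513_transfer_from_weightK_member_of_bdd_ofLevel_odd ∧
      DeligneSerre1974.thm61_exists_adicGaloisRep ∧ Hida2000_thm326_ordinary ∧
      kato_charIdeal_dvd_multiplicative_of_surjective ∧ lemma20_surjective_threeAdic_of_semistable ∧
      Kato2004.thm12_4 ∧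
      Kato2004.exists_multDivisibilityInputs_nonsplit_contra ∧
      Kato2004.exists_multDivisibilityInputs_split_contra ∧
      Kato2004.exists_multDivisibilityInputs_fine_contra ∧
      mazur_not_dvd_maninConstant_of_odd ∧
      thm61_splitMultiplicative ∧ thm61_nonsplitMultiplicative ∧
      rank_eq_analyticRank_of_analyticRank_le_one ∧
      (∀ (W : WeierstrassCurve ℚ) [W.IsElliptic] [W.IsGloballyMinimal] (p : ℕ) [Fact p.Prime],
        p ≠ 2 → greenberg_stevens (W := W) (p := p)))
    (hcert5 : ∀ (W : WeierstrassCurve ℚ) [W.IsElliptic] [W.IsGloballyMinimal] (p : ℕ) [Fact p.Prime],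
      ClassX11a W p → 5 ≤ p → ¬ X11a.ShaAnUnit W p → X11a.MuAnZeroAt W p)
    (hmem3 : ∀ (W : WeierstrassCurve ℚ) [W.IsElliptic] [W.IsGloballyMinimal] (p : ℕ) [Fact p.Prime],
      ClassX11a W p → p = 3 → ¬ X11a.ShaAnUnit W p → MemberRatEqAt W p) :
    Theses.ErratumRoadFive.X11aLowerHalf :=
  x11aLowerHalf_body_of_muAnFive_memberRatEqAtThree_of_printFactsLower hP hcert5 hmem3

/-- The `PrintX11a` spelling of the same glue (the two route decls are one statement, `Iff.rfl`). [cite: Miller2011LMS, Def. 1.1] -/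
theorem x11aLowerHalf_printX11a_of_printFactsLower_of_muAnFive_of_memberRatEqAtThree
    (hP : exists_isNewformOf ∧
      thm311_cotorsion_weightK_member_ofLevel_odd ∧ thm1_muAlg_of_weightK_member_ofLevel_odd ∧
      Wan2015.thm4_rational_weightK_member_of_bdd_ofLevel_irred ∧
      thm513_transfer_from_weightK_member_of_bdd_ofLevel_odd ∧
      DeligneSerre1974.thm61_exists_adicGaloisRep ∧ Hida2000_thm326_ordinary ∧
      kato_charIdeal_dvd_multiplicative_of_surjective ∧ lemma20_surjective_threeAdic_of_semistable ∧
      Kato2004.thm12_4 ∧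
      Kato2004.exists_multDivisibilityInputs_nonsplit_contra ∧
      Kato2004.exists_multDivisibilityInputs_split_contra ∧
      Kato2004.exists_multDivisibilityInputs_fine_contra ∧
      mazur_not_dvd_maninConstant_of_odd ∧
      thm61_splitMultiplicative ∧ thm61_nonsplitMultiplicative ∧
      rank_eq_analyticRank_of_analyticRank_le_one ∧
      (∀ (W : WeierstrassCurve ℚ) [W.IsElliptic] [W.IsGloballyMinimal] (p : ℕ) [Fact p.Prime],
        p ≠ 2 → greenberg_stevens (W := W) (p := p)))
    (hcert5 : ∀ (W : WeierstrassCurve ℚ) [W.IsElliptic] [W.IsGloballyMinimal] (p : ℕ) [Fact p.Prime],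
      ClassX11a W p → 5 ≤ p → ¬ X11a.ShaAnUnit W p → X11a.MuAnZeroAt W p)
    (hmem3 : ∀ (W : WeierstrassCurve ℚ) [W.IsElliptic] [W.IsGloballyMinimal] (p : ℕ) [Fact p.Prime],
      ClassX11a W p → p = 3 → ¬ X11a.ShaAnUnit W p → MemberRatEqAt W p) :
    Theses.PrintX11a.X11aLowerHalf :=
  x11aLowerHalf_body_of_muAnFive_memberRatEqAtThree_of_printFactsLower hP hcert5 hmem3

end ClassLevel

end Summit.BirchSwinnertonDyer.BirchSwinnertonDyer.Theorems.OddChain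

end
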